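import Summits.BirchSwinnertonDyer.BirchSwinnertonDyer.Theses.CMKolyvaginAtInertTwo
import Summits.BirchSwinnertonDyer.BirchSwinnertonDyer.Theorems.CMKolyvaginAtInertTwoCMExactDescentAtTwo
import HarnessLib

/-! Scratch (bsd-line-cmk2-p1 g2): kernel check of the TURNKEY route edit for item 22837 —
the `…OfFacts` twin, the three new support items, the re-pointed `closes`, and the one-line closer. -/

namespace Scratch.CMKolyvaginAtInertTwoEdit

open Summit.BirchSwinnertonDyer.BirchSwinnertonDyer.Theses.CMKolyvaginAtInertTwo

/-- NEW crux twin (to replace `CMExactDescentAtTwo` in `closes`). -/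
def CMExactDescentAtTwoOfFacts : Prop :=
  ((∀ (N : ℕ) [NeZero N] (W : WeierstrassCurve ℚ) (K : Type) [Field K] [NumberField K],
      Literature.NumberTheory.EllipticCurves.gross_zagier N W K) ∧
    Literature.NumberTheory.EllipticCurves.rank_eq_analyticRank_of_analyticRank_le_one ∧
    WeierstrassCurve.hasEntireLFunction_rat ∧
    Literature.NumberTheory.EllipticCurves.Milne1972.bsdQuotient_baseChange_quadratic_anyModel) →
  CMExactDescentAtTwo

/-- NEW support item (cite-level, by name): Gross–Zagier at every level. -/
def GrossZagierAllLevels : Prop :=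
  ∀ (N : ℕ) [NeZero N] (W : WeierstrassCurve ℚ) (K : Type) [Field K] [NumberField K],
    Literature.NumberTheory.EllipticCurves.gross_zagier N W K

/-- NEW support item (cite-level, by name): GZK rank part (= PrintCf2's 19921 `RankEqAnalyticRankLeOne`). -/
def RankEqAnalyticRankLeOne : Prop :=
  Literature.NumberTheory.EllipticCurves.rank_eq_analyticRank_of_analyticRank_le_one

/-- NEW support item (cite-level, by name): Milne 1972 Thm 1, any model. -/
def MilneAnyModel : Prop :=
  Literature.NumberTheory.EllipticCurves.Milne1972.bsdQuotient_baseChange_quadratic_anyModel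

/-- The re-pointed deciding theorem: all nine binders used. -/
theorem closes' (hP : CMPrimitiveSupplyAtInertTwo) (hX : CMKolyvaginExactAtInertTwo)
    (hGf : CMExactDescentAtTwoOfFacts) (hR : OffHabitatCMResidualAtTwo) (hBF : CMRankZeroBSDTriple)
    (hL : EntireLFunctionRat) (hGZ : GrossZagierAllLevels) (hGZK : RankEqAnalyticRankLeOne)
    (hMi : MilneAnyModel) : Summit.BirchSwinnertonDyer.WAllCornerFTwo :=
  closes hP hX (hGf ⟨hGZ, hGZK, hL, hMi⟩) hR hBF hL

/-- The closer of the twin, already in the tree (p581565). -/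
theorem cmExactDescentAtTwoOfFacts_proof : CMExactDescentAtTwoOfFacts :=
  Summit.BirchSwinnertonDyer.BirchSwinnertonDyer.Theorems.CMExactDescent.cmExactDescentAtTwo_ofFacts

end Scratch.CMKolyvaginAtInertTwoEdit
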